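import Literature.NumberTheory.Automorphic.RegularAlgebraicCuspidalHeckePointOfEigenclassExists
import Literature.NumberTheory.Automorphic.BianchiCuspidalEigenclassHolds
import HarnessLib

/-!
# Discharged fact: regular algebraic cuspidal automorphic representations of `GL₂` over an
# imaginary quadratic field give points of the completed Hecke algebra (Scholze 2015, Cor. V.4.2)

`Literature.NumberTheory.Automorphic.bianchi_regularAlgebraicCuspidal_isHeckePoint`
(`Automorphic/RegularAlgebraicCuspidalHeckePoint`) was reduced in the tree to the single named fact
`bianchi_cuspidal_regularLAlgebraic_eigenclassExists` (the Eichler–Shimura–Harder eigenclass;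
Harder 1987, §3; the input to Scholze 2015, Cor. V.4.2) by
`bianchi_regularAlgebraicCuspidal_isHeckePoint_of_eigenclassExists`
(`Automorphic/RegularAlgebraicCuspidalHeckePointOfEigenclassExists`).  That fact is a theorem of the
tree (`bianchi_cuspidal_regularLAlgebraic_eigenclassExists_holds`,
`Automorphic/BianchiCuspidalEigenclassHolds`), so the discharge is the one-line application below.
No statement is changed; no definition, no new named fact (D-0026); net Literature debt **−1**.

## References

* P. Scholze, *On torsion in the cohomology of locally symmetric varieties*, Ann. of Math. 182
  (2015), §V.4, Thm. V.4.1 and Cor. V.4.2. [Scholze2015]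
* G. Harder, *Eisenstein cohomology of arithmetic groups. The case `GL₂`*, Invent. Math. 89 (1987),
  §3. [Harder1987]
-/

noncomputable section

namespace Literature.NumberTheory.Automorphic

/-- **Scholze 2015, Cor. V.4.2 for Bianchi groups — the named fact
`bianchi_regularAlgebraicCuspidal_isHeckePoint` holds**: a regular algebraic cuspidal automorphic
representation of `GL₂` over an imaginary quadratic field, unramified outside `S`, defines a point
of the completed (big) Hecke algebra of the tree's statement
(`bianchi_regularAlgebraicCuspidal_isHeckePoint_of_eigenclassExists` applied to
`bianchi_cuspidal_regularLAlgebraic_eigenclassExists_holds`).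
[cite: Scholze2015, §V.4, Cor. V.4.2 with the proof of Thm. V.4.1] [cite: Harder1987, §3] -/
theorem bianchi_regularAlgebraicCuspidal_isHeckePoint_holds :
    bianchi_regularAlgebraicCuspidal_isHeckePoint :=
  bianchi_regularAlgebraicCuspidal_isHeckePoint_of_eigenclassExists
    bianchi_cuspidal_regularLAlgebraic_eigenclassExists_holds

end Literature.NumberTheory.Automorphic

end
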